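import Literature.NumberTheory.EllipticCurves.IwasawaEulerCharRankZeroProofs
import HarnessLib

/-!
# Kato 2004, §14.14–14.15 run with Conjecture 12.10 in place of Theorem 12.5 (4): the DESCENT of the
# main conjecture to the trivial character — `#H²(ℤ[1/p],T) = [H¹(ℤ[1/p],T) : z]` (`μ = 1`) — and its
# converse, PROVED as module theory over `Λ = ℤ_p⟦T⟧`

K. Kato, *`p`-adic Hodge theory and values of zeta functions of modular forms*, Astérisque **295**
(2004) 117–290 [Kato2004Asterisque]. Thm. 14.5 (3) (p. 236) is the inequality
`#H²(ℤ[1/p],T) ≤ [H¹(ℤ[1/p],T) : z]`, and Kato adds (p. 237): "The Tamagawa number conjecture in [BK2]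
generalized by [FP], [KK2] predicts `#(H²(ℤ[1/p],T)) = [H¹(ℤ[1/p],T) : z]` in 14.5 (3)." Its proof
is §14.14 (p. 243): with `𝔭 = Ker(Λ → O_λ, G_∞ ↦ 1)`, `a` a generator of `𝔭`,

> "By the argument as in 13.8, we have an exact sequence
> (14.14.1) `0 → 𝐇¹(T)/a𝐇¹(T) → H¹(ℤ[1/p],T) → _a𝐇²(T) → 0`
> and an isomorphism (14.14.2) `𝐇²(T)/a𝐇²(T) ≅ H²(ℤ[1/p],T)`. By Lemma 14.15 below which we apply by
> taking `Λ` as `A` and `𝐇²(T)` and `𝐇¹(T)/Z(f,T)` as `M`, we obtain from 12.5 (4)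
> `#(𝐇²(T)/a𝐇²(T)) · #(_a𝐇²(T))⁻¹ ≤ [𝐇¹(T)/a𝐇¹(T) : z]` … Hence
> `#(H²(ℤ[1/p],T)) = #(𝐇²(T)/a𝐇²(T)) ≤ #(_a𝐇²(T)) · [𝐇¹(T)/a𝐇¹(T) : z] = [H¹(ℤ[1/p],T) : z]`."

(Lemma 14.15, p. 244: for a finitely generated `M` over a Noetherian `A` with support of
codimension `≥ 1` and `M_𝔮 = 0` at the height-one primes `𝔮 ∋ a`,
`[M/aM] − [_aM] = Σ_𝔮 length(M_𝔮)·[A/(𝔮 + aA)]` in the Grothendieck group of modules with support of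
codimension `≥ 2`.) Here `𝐇^q(T) = lim H^q(ℤ[ζ_{pⁿ}, 1/p], T)` (8.1/12.1), `Z(f,T) ⊂ 𝐇¹(T) ⊗ ℚ` is
the `Λ`-module of zeta elements (12.5 (4): `Z(f,T) ⊂ 𝐇¹(T)` under `p ≠ 2` + (12.5.2)), `𝐇¹(T)` is
torsion free of `Λ ⊗ ℚ`-rank one and `𝐇²(T)` is torsion (Thm. 12.4, p. 221), and `z` is the image of
`z_γ^{(p)}` under (14.13.1) `𝐇¹ → H¹(ℤ[1/p], ·)`. The only input of §14.14 taken from Thm. 12.5 (4) is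
the INEQUALITY `length_{Λ_𝔮} 𝐇²(T)_𝔮 ≤ length_{Λ_𝔮} (𝐇¹(T)/Z(f,T))_𝔮` at the height-one primes `𝔮`;
**Conjecture 12.10** (p. 224) is the EQUALITY: "`Z(f,T)_𝔭 ⊂ 𝐇¹(T)_𝔭` and
`length_{Λ_𝔭}(𝐇²(T)_𝔭) = length_{Λ_𝔭}(𝐇¹(T)_𝔭/Z(f,T)_𝔭)`" for every height-one `𝔭`. Running
§14.14–14.15 with the equality gives the equality `#H²(ℤ[1/p],T) = [H¹(ℤ[1/p],T) : z]`, i.e.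
`μ = 1` in Prop. 14.16 (2) — the statement the Tamagawa number conjecture "predicts" (p. 237), and the
one missing input of the `p`-part of the Birch–Swinnerton-Dyer formula in analytic rank `0` read
through Prop. 14.16 (2) (cell `b2b-bsdres` / `bsd-potss`: tree facts
`Kato2004.rankZero_padicValNat_sha_add_padicValNat_tamagawa_le_of_additive_potGood_of_imageContainsSL2`
— the `≤` with Kato's `μ` forgotten — and the O6 node `O6.MainConjectureEvenIffBSDThree`, whose
descent identities `hm`/`hζ` were HYPOTHESES; this file proves them).

## What is proved (theorems only; no definition, no named fact — D-0014/D-0026)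

Everything on the `Δ`-trivial component, i.e. over `Λ = ℤ_p⟦T⟧ = IwasawaAlgebra p` (`T = γ − 1`,
`a = T`; Kato's `Λ = O_λ⟦G_∞⟧` is the product of `#Δ` copies of it and 12.10 is component-wise), with
Kato's objects as VARIABLES: `H` (`= 𝐇¹(T)^{(0)}`: finitely generated, torsion free — Thm. 12.4 (2)),
`z ∈ H`, `z ≠ 0` (the zeta element; `Z = Λz`), `H ⧸ Λz` torsion (`Λ ⊗ ℚ`-rank one, 12.4 (2)), `H2`
(`= 𝐇²(T)^{(0)}`: finitely generated torsion, 12.4 (1)), `A` (`= H¹(ℤ[1/p],T)`) with the exact sequence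
(14.14.1) `0 → H/TH →ι A →π H2[T] → 0` (`Λ`-linear; `Λ` acts on `A` through `Λ/T = ℤ_p`), and the
finiteness of `H2/TH2` (`= H²(ℤ[1/p],T)` by (14.14.2); finite in analytic rank `0`, Thm. 14.5 (1)).
Kato's index `[A : z]` is `#(A ⧸ Λ·ι(z̄))` (`z̄ = z mod TH`; p. 236: `[M : z] = [M : O_L y]·[O_L : c]⁻¹`
with `y = z`, `c = 1`, as `z ∈ 𝐇¹(T)` is integral under (12.5.2)).

* `Kato2004.lengthAt_primeT_eq_zero_of_finite_coinvariants`, `….natCard_coinvariants_eq_of_finite` —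
  Lemma 14.15 at `a = T` for a finitely generated torsion `M` with `M/TM` finite:
  `ℓ_{(T)}(M) = 0` and `#(M/TM) = #M[T] · p^{e(M)}`, `e(M) = Σ_{𝔮 ≠ (T)} ℓ_𝔮(M)·v_p(q_𝔮(0))` (the
  tree's `IwasawaAlgebra.eulerExp`; this is `card_coinvariants_of_lengthAt_eq_zero` of
  `IwasawaEulerCharProofs` with its hypothesis discharged).
* `Kato2004.eulerExp_eq_of_lengthAt_eq` — Conj. 12.10 (equal local lengths at every height-one
  prime) ⇒ `e(H2) = e(H/Λz)`.
* `Kato2004.invariants_quotient_span_eq_bot` — **`(H/Λz)[T] = 0`** when `H` is torsion free, `z ≠ 0`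
  and `(H/Λz)[T]` is finite ("by the argument as in 13.8": `(H/Z)[T] ↪ Z/TZ ≅ ℤ_p`).
* `Kato2004.natCard_coinvariants_quotient_span` — `#((H/Λz)/T) = #((H/TH) ⧸ Λ z̄)`.
* `Kato2004.natCard_quotient_eq_of_exact` — along (14.14.1), `#(A ⧸ Λ·ι z̄) = #H2[T] · #((H/TH) ⧸ Λ z̄)`.
* **`Kato2004.index_zeta_eq_natCard_coinvariants_of_conj_12_10`** — THE DESCENT: under Conj. 12.10,
  `#(A ⧸ Λ·ι z̄) = #(H2/TH2)`, i.e. `[H¹(ℤ[1/p],T) : z] = #H²(ℤ[1/p],T)` (`μ = 1`).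
* **`Kato2004.lengthAt_eq_of_index_zeta_eq_natCard_coinvariants`** — THE CONVERSE: under the
  inequality of Thm. 12.5 (4) at every height-one prime, `μ = 1` implies Conj. 12.10 (on this
  component) at EVERY height-one prime (`e(H2) ≤ e(H/Z)` termwise with equal sums, and both
  `ℓ_{(T)}` vanish).

So, modulo the IDENTIFICATION of `H, z, H2, A` with Kato's objects and the two descent statements
(14.14.1)–(14.14.2) (printed, "by the argument as in 13.8"; on the tree side these are the seams (i)–(ii)
named in `Summits/…/O6/MainConjectureEvenIffBSD.lean`), Kato's Main Conjecture 12.10 on the trivial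
tame component is EQUIVALENT to `μ = 1`; nothing about Kato's objects is defined or asserted here.
Companion of `Kato2004/MainConjectureSkeletonProofs.lean` (12.10 ⟺ 17.6) and
`Kato2004/SelmerCountSkeletonProofs.lean` (the count 14.16 (2) ⊕ 14.5 (3)).

References: [Kato2004Asterisque] Thm. 12.4 (p. 221), Thm. 12.5 (4) and (12.5.2) (p. 222), Conj.
12.10 (p. 224), 13.8 (pp. 227–229), Thm. 14.5 and the index `[M : z]` (pp. 236–237), §14.14 with
(14.14.1)–(14.14.2) and Lemma 14.15 (pp. 243–244), Prop. 14.16 (p. 244). The `Γ`-Euler characteristic: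
[GreenbergLNM1716] §4 Lemma 4.2; [Washington1997] §13.2 (tree: `IwasawaEulerCharProofs`,
`IwasawaEulerCharRankZeroProofs`).
-/

noncomputable section

open scoped Classical

universe u

namespace Literature.NumberTheory.EllipticCurves.Kato2004

open Literature.NumberTheory.EllipticCurves.IwasawaAlgebra

variable {p : ℕ} [Fact p.Prime]

/-! ### §1 Lemma 14.15 at `a = T`: a finitely generated torsion `M` with `M/TM` finite -/

section EulerChar

variable (M : Type u) [AddCommGroup M] [Module (IwasawaAlgebra p) M]
  [Module.Finite (IwasawaAlgebra p) M] (hM : Module.IsTorsion (IwasawaAlgebra p) M)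
include hM

/-- **`M/TM` finite ⇒ `ℓ_{(T)}(M) = 0`** for a finitely generated torsion `Λ`-module (`M` has no
`(T)`-primary component; Kato, Lemma 14.15: "`M_𝔭 = 0` for any prime ideal `𝔭` of height one which
contains `a`" is exactly this at `a = T`). Proof: `ℓ(M) = ℓ(TM) + ℓ(M/TM)`, `ℓ(M/TM) = 0` (finite and
killed by `T`), and `ℓ(TM) = 0 ⟺ ℓ(ker φ_M) = 0` with `ker φ_M ⊆ M[T]` finite.
[cite: Kato2004Asterisque, Lemma 14.15 (p. 244)] [cite: GreenbergLNM1716, §4 Lemma 4.2] -/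
theorem lengthAt_primeT_eq_zero_of_finite_coinvariants (hfin : Finite (coinvariants p M)) :
    Module.lengthAt (IwasawaAlgebra p) M (primeT p) = 0 := by
  haveI := hfin
  haveI : Finite (invariants p M) := (finite_invariants_iff_finite_coinvariants p M hM).mpr hfin
  have hker : Finite (LinearMap.ker (bockstein p M)) :=
    Finite.of_injective _ (Submodule.subtype_injective _)
  have hC : Module.lengthAt (IwasawaAlgebra p) (coinvariants p M) (primeT p) = 0 :=
    (finite_iff_lengthAt_eq_zero_of_X_smul_eq_zero p (coinvariants p M)
      (fun x ↦ X_smul_coinvariants p M x)).mp hfin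
  have hK : Module.lengthAt (IwasawaAlgebra p) (LinearMap.ker (bockstein p M)) (primeT p) = 0 :=
    (finite_iff_lengthAt_eq_zero_of_X_smul_eq_zero p (LinearMap.ker (bockstein p M))
      (fun x ↦ Subtype.ext (X_smul_invariants p M (x : invariants p M)))).mp hker
  have hT : Module.lengthAt (IwasawaAlgebra p) (TSubmodule p M) (primeT p) = 0 :=
    (lengthAt_TSubmodule_eq_zero_iff p M hM).mpr hK
  rw [lengthAt_eq_TSubmodule_add_coinvariants p M, hT, hC, zero_add]

/-- **Lemma 14.15 / the `Γ`-Euler characteristic at `a = T`: `#(M/TM) = #M[T] · p^{e(M)}`** for a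
finitely generated torsion `Λ`-module with `M/TM` finite (then `M[T]` is finite too), where
`e(M) = Σ_{ht 𝔮 = 1, 𝔮 ≠ (T)} ℓ_𝔮(M) · v_p(q_𝔮(0))` — Kato's right-hand side
`Σ_𝔮 length(M_𝔮)·[Λ/(𝔮 + TΛ)]` counted (`#Λ/(q_𝔮, T) = p^{v_p(q_𝔮(0))}`).
[cite: Kato2004Asterisque, Lemma 14.15 (p. 244)] [cite: GreenbergLNM1716, §4 Lemma 4.2] -/
theorem natCard_coinvariants_eq_of_finite (hfin : Finite (coinvariants p M)) :
    Finite (invariants p M) ∧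
      Nat.card (coinvariants p M) = Nat.card (invariants p M) * p ^ eulerExp p M := by
  obtain ⟨h1, -, h3⟩ := card_coinvariants_of_lengthAt_eq_zero M hM
    (lengthAt_primeT_eq_zero_of_finite_coinvariants M hM hfin)
  exact ⟨h1, h3⟩

end EulerChar

/-! ### §2 Conjecture 12.10 as equality of local lengths ⇒ equal Euler exponents -/

/-- **Conj. 12.10 ⇒ `e(H2) = e(H/Z)`**: two `Λ`-modules with the same local length at every
height-one prime have the same `Γ`-Euler exponent (a sum over height-one primes `≠ (T)`).
[cite: Kato2004Asterisque, Conj. 12.10 (p. 224)] -/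
theorem eulerExp_eq_of_lengthAt_eq {M N : Type u} [AddCommGroup M] [Module (IwasawaAlgebra p) M]
    [AddCommGroup N] [Module (IwasawaAlgebra p) N]
    (h : ∀ 𝔮 : PrimeSpectrum (IwasawaAlgebra p), 𝔮.asIdeal.height = 1 →
      Module.lengthAt (IwasawaAlgebra p) M 𝔮 = Module.lengthAt (IwasawaAlgebra p) N 𝔮) :
    eulerExp p M = eulerExp p N := by
  unfold eulerExp
  exact finsum_mem_congr rfl fun 𝔮 h𝔮 ↦ by rw [h 𝔮 h𝔮.1]

/-! ### §3 The zeta line `Z = Λz` in a torsion-free `H` ("the argument as in 13.8") -/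

section ZetaLine

variable {H : Type u} [AddCommGroup H] [Module (IwasawaAlgebra p) H]

/-- **`(H/Λz)[T] = 0`** for `H` torsion free, `z ≠ 0` and `(H/Λz)[T]` finite. (Snake lemma for
multiplication by `T` on `0 → Λz → H → H/Λz → 0`: `H[T] = 0`, so `(H/Λz)[T] ↪ Λz/TΛz ≅ Λ/T = ℤ_p`,
which has no finite non-zero subgroup. Written out: if `T x = λ z` and `n x = κ z` with `n ≥ 1`,
then `nλ = Tκ`, so `λ(0) = 0`, `λ = Tλ'`, `T(x − λ'z) = 0`, `x = λ'z ∈ Λz`.)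
[cite: Kato2004Asterisque, §14.14 (14.14.1) and 13.8 (pp. 227–229, 243)] -/
theorem invariants_quotient_span_eq_bot [NoZeroSMulDivisors (IwasawaAlgebra p) H] (z : H)
    (hz : z ≠ 0) (hfin : Finite (invariants p (H ⧸ (IwasawaAlgebra p) ∙ z))) :
    invariants p (H ⧸ (IwasawaAlgebra p) ∙ z) = ⊥ := by
  rw [eq_bot_iff]
  intro q hq
  rw [Submodule.mem_bot]
  -- `q` has finite additive order `n ≥ 1`
  obtain ⟨n, hn, hnq⟩ := (isOfFinAddOrder_of_finite (⟨q, hq⟩ : invariants p _)).exists_nsmul_eq_zero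
  have hnq' : n • q = 0 := by
    have := congrArg Subtype.val hnq
    simpa using this
  induction q using Submodule.Quotient.induction_on with
  | H x =>
    -- `T x ∈ Λ z` and `n x ∈ Λ z`
    have hTx : (PowerSeries.X : IwasawaAlgebra p) • x ∈ (IwasawaAlgebra p) ∙ z := by
      rw [← Submodule.Quotient.mk_eq_zero, Submodule.Quotient.mk_smul]
      exact (mem_invariants_iff p _ _).mp hq
    have hnx : ((n : IwasawaAlgebra p)) • x ∈ (IwasawaAlgebra p) ∙ z := by
      rw [← Submodule.Quotient.mk_eq_zero, Submodule.Quotient.mk_smul, Nat.cast_smul_eq_nsmul]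
      exact hnq'
    obtain ⟨lam, hlam⟩ := Submodule.mem_span_singleton.mp hTx
    obtain ⟨kap, hkap⟩ := Submodule.mem_span_singleton.mp hnx
    -- `n • lam = X • kap` in `Λ`
    have hrel : ((n : IwasawaAlgebra p) * lam) • z = ((PowerSeries.X : IwasawaAlgebra p) * kap) • z := by
      rw [mul_smul, hlam, mul_smul, hkap, smul_comm]
    have hrel' : (n : IwasawaAlgebra p) * lam = (PowerSeries.X : IwasawaAlgebra p) * kap := by
      have h : ((n : IwasawaAlgebra p) * lam - (PowerSeries.X : IwasawaAlgebra p) * kap) • z = 0 := by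
        rw [sub_smul, hrel, sub_self]
      rcases smul_eq_zero.mp h with h0 | h0
      · exact sub_eq_zero.mp h0
      · exact absurd h0 hz
    -- constant coefficients: `n · lam(0) = 0`, so `lam(0) = 0`
    have hlam0 : PowerSeries.constantCoeff lam = 0 := by
      have h := congrArg PowerSeries.constantCoeff hrel'
      simp only [map_mul, map_natCast, PowerSeries.constantCoeff_X, zero_mul] at h
      rcases mul_eq_zero.mp h with h0 | h0
      · exact absurd h0 (by exact_mod_cast hn.ne')
      · exact h0
    obtain ⟨lam', hlam'⟩ := PowerSeries.X_dvd_iff.mpr hlam0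
    -- `T • (x - lam' • z) = 0`, hence `x = lam' • z`
    have hT0 : (PowerSeries.X : IwasawaAlgebra p) • (x - lam' • z) = 0 := by
      rw [smul_sub, ← hlam, hlam', mul_smul, sub_self]
    rcases smul_eq_zero.mp hT0 with h0 | h0
    · exact absurd h0 PowerSeries.X_ne_zero
    · rw [sub_eq_zero] at h0
      rw [h0, Submodule.Quotient.mk_eq_zero]
      exact Submodule.smul_mem _ _ (Submodule.mem_span_singleton_self z)

/-- `#(H/Λz)[T] = 1` in the situation of `invariants_quotient_span_eq_bot`.
[cite: Kato2004Asterisque, §14.14 (p. 243)] -/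
theorem natCard_invariants_quotient_span_eq_one [NoZeroSMulDivisors (IwasawaAlgebra p) H] (z : H)
    (hz : z ≠ 0) (hfin : Finite (invariants p (H ⧸ (IwasawaAlgebra p) ∙ z))) :
    Nat.card (invariants p (H ⧸ (IwasawaAlgebra p) ∙ z)) = 1 := by
  rw [invariants_quotient_span_eq_bot z hz hfin]
  exact Nat.card_unique

/-- **`(H/Λz)/T ≅ (H/TH) ⧸ Λz̄`**, `z̄ = z mod TH` (both are `H/(Λz + TH)`), as an equality of orders —
the identification behind Kato's `[𝐇¹(T)/a𝐇¹(T) : z]` in §14.14.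
[cite: Kato2004Asterisque, §14.14 (p. 243)] -/
theorem natCard_coinvariants_quotient_span (z : H) :
    Nat.card (coinvariants p (H ⧸ (IwasawaAlgebra p) ∙ z)) =
      Nat.card (coinvariants p H ⧸
        (IwasawaAlgebra p) ∙ (Submodule.Quotient.mk z : coinvariants p H)) := by
  set I : Ideal (IwasawaAlgebra p) := Ideal.span {(PowerSeries.X : IwasawaAlgebra p)} with hI
  set Z : Submodule (IwasawaAlgebra p) H := (IwasawaAlgebra p) ∙ z with hZ
  -- left: `(H/Z)/(I • ⊤) = (H/Z)/((I • ⊤).map Z.mkQ) ≃ H/(Z ⊔ I • ⊤)`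
  have hL : (I • (⊤ : Submodule (IwasawaAlgebra p) (H ⧸ Z))) =
      (I • (⊤ : Submodule (IwasawaAlgebra p) H)).map Z.mkQ := by
    rw [Submodule.map_smul'', Submodule.map_top, Submodule.range_mkQ]
  have eL : coinvariants p (H ⧸ Z) ≃ₗ[IwasawaAlgebra p]
      H ⧸ (Z ⊔ I • (⊤ : Submodule (IwasawaAlgebra p) H)) :=
    (Submodule.quotEquivOfEq _ _ hL).trans (Submodule.quotientQuotientEquivQuotientSup Z _)
  -- right: `(H/I•⊤)/(Z.map mkQ) ≃ H/(I • ⊤ ⊔ Z)`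
  have hR : ((IwasawaAlgebra p) ∙ (Submodule.Quotient.mk z : coinvariants p H)) =
      Z.map (I • (⊤ : Submodule (IwasawaAlgebra p) H)).mkQ := by
    rw [hZ, Submodule.map_span, Set.image_singleton, Submodule.mkQ_apply]
  have eR : (coinvariants p H ⧸ (IwasawaAlgebra p) ∙ (Submodule.Quotient.mk z : coinvariants p H))
      ≃ₗ[IwasawaAlgebra p] H ⧸ (I • (⊤ : Submodule (IwasawaAlgebra p) H) ⊔ Z) :=
    (Submodule.quotEquivOfEq _ _ hR).trans (Submodule.quotientQuotientEquivQuotientSup _ Z)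
  rw [Nat.card_congr eL.toEquiv, Nat.card_congr eR.toEquiv, sup_comm]

end ZetaLine

/-! ### §4 The count along (14.14.1) -/

section LevelZero

variable {H H2 A : Type u} [AddCommGroup H] [Module (IwasawaAlgebra p) H]
  [AddCommGroup H2] [Module (IwasawaAlgebra p) H2] [AddCommGroup A] [Module (IwasawaAlgebra p) A]

/-- **Along (14.14.1) `0 → H/TH →ι A →π H2[T] → 0`: `[A : Λ·ι(z̄)] = #H2[T] · [H/TH : Λz̄]`**
(`#(A ⧸ Λ·ι z̄) = #(A ⧸ ι(H/TH)) · #(ι(H/TH) ⧸ Λ·ι z̄)`, with `A ⧸ ι(H/TH) ≅ H2[T]` and `ι` injective).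
Stated with `Nat.card` (an infinite quotient has `Nat.card = 0`), so no finiteness is assumed.
[cite: Kato2004Asterisque, §14.14, (14.14.1) (p. 243)] -/
theorem natCard_quotient_eq_of_exact (ι : coinvariants p H →ₗ[IwasawaAlgebra p] A)
    (π : A →ₗ[IwasawaAlgebra p] invariants p H2) (hι : Function.Injective ι)
    (hπ : Function.Surjective π) (hex : Function.Exact ι π) (w : coinvariants p H) :
    Nat.card (A ⧸ (IwasawaAlgebra p) ∙ ι w) =
      Nat.card (invariants p H2) * Nat.card (coinvariants p H ⧸ (IwasawaAlgebra p) ∙ w) := by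
  -- `Λ·ι w = (Λ·w).map ι ≤ range ι`
  have hmap : ((IwasawaAlgebra p) ∙ ι w) = ((IwasawaAlgebra p) ∙ w).map ι := by
    rw [Submodule.map_span, Set.image_singleton]
  have hle : ((IwasawaAlgebra p) ∙ ι w) ≤ LinearMap.range ι := by
    rw [hmap]; exact LinearMap.map_le_range
  -- `#(A/Λιw) = #(A/range ι) · #(range ι / Λιw)`
  have h1 : Nat.card (A ⧸ (IwasawaAlgebra p) ∙ ι w) =
      Nat.card ((LinearMap.range ι).map ((IwasawaAlgebra p) ∙ ι w).mkQ) *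
        Nat.card ((A ⧸ (IwasawaAlgebra p) ∙ ι w) ⧸
          (LinearMap.range ι).map ((IwasawaAlgebra p) ∙ ι w).mkQ) :=
    Submodule.card_eq_card_quotient_mul_card _
  -- `(A/Λιw)/(range ι) ≃ A / range ι ≃ H2[T]`
  have e2 : ((A ⧸ (IwasawaAlgebra p) ∙ ι w) ⧸
      (LinearMap.range ι).map ((IwasawaAlgebra p) ∙ ι w).mkQ) ≃ₗ[IwasawaAlgebra p]
        invariants p H2 :=
    (Submodule.quotientQuotientEquivQuotient _ _ hle).trans
      ((Submodule.quotEquivOfEq _ _ (LinearMap.exact_iff.mp hex).symm).trans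
        (LinearMap.quotKerEquivOfSurjective π hπ))
  -- `(range ι).map mkQ = range (mkQ ∘ ι) ≃ (H/TH) / ker (mkQ ∘ ι) = (H/TH) / Λw`
  set φ : coinvariants p H →ₗ[IwasawaAlgebra p] A ⧸ (IwasawaAlgebra p) ∙ ι w :=
    ((IwasawaAlgebra p) ∙ ι w).mkQ.comp ι with hφ
  have hker : LinearMap.ker φ = (IwasawaAlgebra p) ∙ w := by
    rw [hφ, LinearMap.ker_comp, Submodule.ker_mkQ, hmap, Submodule.comap_map_eq,
      LinearMap.ker_eq_bot.mpr hι, sup_bot_eq]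
  have hrange : LinearMap.range φ = (LinearMap.range ι).map ((IwasawaAlgebra p) ∙ ι w).mkQ := by
    rw [hφ, LinearMap.range_comp]
  have e3 : (coinvariants p H ⧸ (IwasawaAlgebra p) ∙ w) ≃ₗ[IwasawaAlgebra p]
      (LinearMap.range ι).map ((IwasawaAlgebra p) ∙ ι w).mkQ :=
    ((Submodule.quotEquivOfEq _ _ hker).symm.trans φ.quotKerEquivRange).trans
      (LinearEquiv.ofEq _ _ hrange)
  rw [h1, ← Nat.card_congr e3.toEquiv, Nat.card_congr e2.toEquiv, mul_comm]

end LevelZero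

/-! ### §5 THE DESCENT: Conjecture 12.10 ⇒ `[H¹(ℤ[1/p],T) : z] = #H²(ℤ[1/p],T)` (`μ = 1`) -/

section Descent

variable {H H2 A : Type u} [AddCommGroup H] [Module (IwasawaAlgebra p) H]
  [AddCommGroup H2] [Module (IwasawaAlgebra p) H2] [AddCommGroup A] [Module (IwasawaAlgebra p) A]
  [Module.Finite (IwasawaAlgebra p) H] [NoZeroSMulDivisors (IwasawaAlgebra p) H]
  [Module.Finite (IwasawaAlgebra p) H2]

/-- **Kato's §14.14 run with Conjecture 12.10: `#((H/Λz)/T) = p^{e(H2)}` and `#(H2/TH2) =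
#H2[T] · p^{e(H2)}`** — the two Euler characteristics of Lemma 14.15 for `M = 𝐇²(T)` and
`M = 𝐇¹(T)/Z(f,T)` coincide under 12.10, and `(𝐇¹/Z)[T] = 0`.
[cite: Kato2004Asterisque, §14.14 and Lemma 14.15 (pp. 243–244), Conj. 12.10 (p. 224)] -/
theorem natCard_coinvariants_quotient_span_eq_pow_of_conj_12_10 (z : H) (hz : z ≠ 0)
    (hHZ : Module.IsTorsion (IwasawaAlgebra p) (H ⧸ (IwasawaAlgebra p) ∙ z))
    (hH2 : Module.IsTorsion (IwasawaAlgebra p) H2)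
    (hMC : ∀ 𝔮 : PrimeSpectrum (IwasawaAlgebra p), 𝔮.asIdeal.height = 1 →
      Module.lengthAt (IwasawaAlgebra p) H2 𝔮 =
        Module.lengthAt (IwasawaAlgebra p) (H ⧸ (IwasawaAlgebra p) ∙ z) 𝔮)
    (hfin : Finite (coinvariants p H2)) :
    Nat.card (coinvariants p (H ⧸ (IwasawaAlgebra p) ∙ z)) = p ^ eulerExp p H2 ∧
      Nat.card (coinvariants p H2) = Nat.card (invariants p H2) * p ^ eulerExp p H2 := by
  -- `ℓ_{(T)}(H2) = 0`, hence `ℓ_{(T)}(H/Z) = 0` by 12.10 at `𝔮 = (T)`, hence `(H/Z)/T` finite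
  have hT2 : Module.lengthAt (IwasawaAlgebra p) H2 (primeT p) = 0 :=
    lengthAt_primeT_eq_zero_of_finite_coinvariants H2 hH2 hfin
  have hTZ : Module.lengthAt (IwasawaAlgebra p) (H ⧸ (IwasawaAlgebra p) ∙ z) (primeT p) = 0 := by
    rw [← hMC (primeT p) (height_primeT p), hT2]
  obtain ⟨hfinZT, hfinZ, hcardZ⟩ :=
    card_coinvariants_of_lengthAt_eq_zero (H ⧸ (IwasawaAlgebra p) ∙ z) hHZ hTZ
  obtain ⟨-, hcard2⟩ := natCard_coinvariants_eq_of_finite H2 hH2 hfin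
  refine ⟨?_, hcard2⟩
  rw [hcardZ, natCard_invariants_quotient_span_eq_one z hz hfinZT, one_mul,
    eulerExp_eq_of_lengthAt_eq hMC]

/-- **THE DESCENT OF THE MAIN CONJECTURE TO THE TRIVIAL CHARACTER (Kato, §14.14–14.15 with
Conj. 12.10; p. 237 "the Tamagawa number conjecture … predicts `#(H²(ℤ[1/p],T)) = [H¹(ℤ[1/p],T) : z]`").**
Over `Λ = ℤ_p⟦T⟧`: let `H` be finitely generated and torsion free (`𝐇¹(T)`, Thm. 12.4 (2)), `z ∈ H`
non-zero with `H/Λz` torsion (the zeta element; `𝐇¹` has rank one), `H2` finitely generated torsion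
(`𝐇²(T)`, Thm. 12.4 (1)), `0 → H/TH →ι A →π H2[T] → 0` exact ((14.14.1), `A = H¹(ℤ[1/p],T)`) and
`H2/TH2` finite ((14.14.2): `= H²(ℤ[1/p],T)`, finite by Thm. 14.5 (1) when `L(f,r) ≠ 0`). **If Conj.
12.10 holds — `length_{Λ_𝔮} (H2)_𝔮 = length_{Λ_𝔮} (H/Λz)_𝔮` at every height-one prime `𝔮` — then
`[A : Λ·ι(z̄)] = #(H2/TH2)`**, i.e. `[H¹(ℤ[1/p],T) : z] = #H²(ℤ[1/p],T)`: Kato's `μ` of Prop. 14.16 (2)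
equals `1`. Module theory only: nothing about Kato's objects is asserted.
[cite: Kato2004Asterisque, §14.14 (14.14.1)–(14.14.2) and Lemma 14.15 (pp. 243–244), Conj. 12.10 (p. 224), Thm. 14.5 (3) and p. 237] -/
theorem index_zeta_eq_natCard_coinvariants_of_conj_12_10 (z : H) (hz : z ≠ 0)
    (hHZ : Module.IsTorsion (IwasawaAlgebra p) (H ⧸ (IwasawaAlgebra p) ∙ z))
    (hH2 : Module.IsTorsion (IwasawaAlgebra p) H2)
    (hMC : ∀ 𝔮 : PrimeSpectrum (IwasawaAlgebra p), 𝔮.asIdeal.height = 1 →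
      Module.lengthAt (IwasawaAlgebra p) H2 𝔮 =
        Module.lengthAt (IwasawaAlgebra p) (H ⧸ (IwasawaAlgebra p) ∙ z) 𝔮)
    (ι : coinvariants p H →ₗ[IwasawaAlgebra p] A) (π : A →ₗ[IwasawaAlgebra p] invariants p H2)
    (hι : Function.Injective ι) (hπ : Function.Surjective π) (hex : Function.Exact ι π)
    (hfin : Finite (coinvariants p H2)) :
    Nat.card (A ⧸ (IwasawaAlgebra p) ∙ ι (Submodule.Quotient.mk z)) =
      Nat.card (coinvariants p H2) := by
  obtain ⟨hZ, h2⟩ := natCard_coinvariants_quotient_span_eq_pow_of_conj_12_10 z hz hHZ hH2 hMC hfin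
  rw [natCard_quotient_eq_of_exact ι π hι hπ hex, ← natCard_coinvariants_quotient_span z, hZ, h2]

end Descent

/-! ### §6 THE CONVERSE: `μ = 1` and the divisibility of Thm. 12.5 (4) ⇒ Conjecture 12.10 -/

section Converse

/-- `v_p(q_𝔮(0)) ≥ 1` for a height-one prime `𝔮 ≠ (T)` of `Λ`: the generator `q_𝔮` is a prime,
hence not a unit, so its constant term is not a unit of `ℤ_p`. [cite: Washington1997, §13.2] -/
theorem one_le_constVal {𝔮 : PrimeSpectrum (IwasawaAlgebra p)} (h𝔮 : 𝔮 ∈ heightOneNeT p) :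
    1 ≤ constVal p 𝔮 := by
  have hne : PowerSeries.constantCoeff (primeGen p 𝔮) ≠ 0 :=
    constantCoeff_primeGen_ne_zero h𝔮.1 h𝔮.2
  have hnu : ¬ IsUnit (PowerSeries.constantCoeff (primeGen p 𝔮)) := by
    intro hu
    exact (prime_primeGen h𝔮.1).not_unit (PowerSeries.isUnit_iff_constantCoeff.mpr hu)
  unfold constVal
  have hdvd : (p : ℤ_[p]) ∣ PowerSeries.constantCoeff (primeGen p 𝔮) :=
    (PadicInt.norm_lt_one_iff_dvd _).mp (PadicInt.not_isUnit_iff.mp hnu)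
  rw [← PadicInt.mem_span_pow_iff_le_valuation _ hne 1, pow_one]
  exact Ideal.mem_span_singleton.mpr hdvd

variable {H H2 A : Type u} [AddCommGroup H] [Module (IwasawaAlgebra p) H]
  [AddCommGroup H2] [Module (IwasawaAlgebra p) H2] [AddCommGroup A] [Module (IwasawaAlgebra p) A]
  [Module.Finite (IwasawaAlgebra p) H] [NoZeroSMulDivisors (IwasawaAlgebra p) H]
  [Module.Finite (IwasawaAlgebra p) H2]

/-- **The converse descent: `μ = 1` ⇒ Conj. 12.10 (on this component), granted the divisibility of
Thm. 12.5 (4).** Same data as `index_zeta_eq_natCard_coinvariants_of_conj_12_10`; assume Kato's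
theorem `length (H2)_𝔮 ≤ length (H/Λz)_𝔮` at every height-one `𝔮` (Thm. 12.5 (4), under `p ≠ 2` and
(12.5.2)) and the EQUALITY `[A : Λ·ι(z̄)] = #(H2/TH2)` (`μ = 1`, e.g. from the `p`-part of the
Birch–Swinnerton-Dyer formula read backwards through Prop. 14.16 (2)). Then
`length (H2)_𝔮 = length (H/Λz)_𝔮` at EVERY height-one prime `𝔮`: at `𝔮 = (T)` both vanish, and off
`(T)` the termwise inequalities `ℓ_𝔮(H2)·v_p(q_𝔮(0)) ≤ ℓ_𝔮(H/Z)·v_p(q_𝔮(0))` have equal sums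
`e(H2) = e(H/Z)` with `v_p(q_𝔮(0)) ≥ 1`.
[cite: Kato2004Asterisque, Thm. 12.5 (4) (p. 222), Conj. 12.10 (p. 224), §14.14 (p. 243)] -/
theorem lengthAt_eq_of_index_zeta_eq_natCard_coinvariants (z : H) (hz : z ≠ 0)
    (hHZ : Module.IsTorsion (IwasawaAlgebra p) (H ⧸ (IwasawaAlgebra p) ∙ z))
    (hH2 : Module.IsTorsion (IwasawaAlgebra p) H2)
    (hdiv : ∀ 𝔮 : PrimeSpectrum (IwasawaAlgebra p), 𝔮.asIdeal.height = 1 →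
      Module.lengthAt (IwasawaAlgebra p) H2 𝔮 ≤
        Module.lengthAt (IwasawaAlgebra p) (H ⧸ (IwasawaAlgebra p) ∙ z) 𝔮)
    (ι : coinvariants p H →ₗ[IwasawaAlgebra p] A) (π : A →ₗ[IwasawaAlgebra p] invariants p H2)
    (hι : Function.Injective ι) (hπ : Function.Surjective π) (hex : Function.Exact ι π)
    (hfin : Finite (coinvariants p H2))
    (hμ : Nat.card (A ⧸ (IwasawaAlgebra p) ∙ ι (Submodule.Quotient.mk z)) =
      Nat.card (coinvariants p H2)) :
    ∀ 𝔮 : PrimeSpectrum (IwasawaAlgebra p), 𝔮.asIdeal.height = 1 →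
      Module.lengthAt (IwasawaAlgebra p) H2 𝔮 =
        Module.lengthAt (IwasawaAlgebra p) (H ⧸ (IwasawaAlgebra p) ∙ z) 𝔮 := by
  haveI := hfin
  set Q := H ⧸ (IwasawaAlgebra p) ∙ z with hQ
  -- the count for `H2`
  obtain ⟨hfin2T, hcard2⟩ := natCard_coinvariants_eq_of_finite H2 hH2 hfin
  -- `(H/Z)/T` is finite: it has the order `#(H/TH ⧸ Λz̄)`, a factor of `[A : Λιz̄] = #(H2/T) ≠ 0`
  have hA : Nat.card (A ⧸ (IwasawaAlgebra p) ∙ ι (Submodule.Quotient.mk z)) =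
      Nat.card (invariants p H2) * Nat.card (coinvariants p Q) := by
    rw [natCard_quotient_eq_of_exact ι π hι hπ hex, ← natCard_coinvariants_quotient_span z]
  have hne : Nat.card (coinvariants p Q) ≠ 0 := by
    intro h0
    rw [h0, mul_zero, hμ] at hA
    exact (Nat.card_pos (α := coinvariants p H2)).ne' hA
  have hfinQ : Finite (coinvariants p Q) := Nat.finite_of_card_ne_zero hne
  have hTQ : Module.lengthAt (IwasawaAlgebra p) Q (primeT p) = 0 :=
    lengthAt_primeT_eq_zero_of_finite_coinvariants Q hHZ hfinQ
  have hT2 : Module.lengthAt (IwasawaAlgebra p) H2 (primeT p) = 0 :=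
    lengthAt_primeT_eq_zero_of_finite_coinvariants H2 hH2 hfin
  obtain ⟨hfinQT, -, hcardQ⟩ := card_coinvariants_of_lengthAt_eq_zero Q hHZ hTQ
  rw [natCard_invariants_quotient_span_eq_one z hz hfinQT, one_mul] at hcardQ
  -- `e(H2) = e(Q)`
  have hE : eulerExp p H2 = eulerExp p Q := by
    have h : Nat.card (invariants p H2) * p ^ eulerExp p H2 =
        Nat.card (invariants p H2) * p ^ eulerExp p Q := by
      rw [← hcard2, ← hμ, hA, hcardQ]
    have hpos : 0 < Nat.card (invariants p H2) := Nat.card_pos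
    exact Nat.pow_right_injective (Fact.out : p.Prime).two_le (Nat.eq_of_mul_eq_mul_left hpos h)
  -- termwise
  intro 𝔮 h𝔮
  by_cases hT : 𝔮 = primeT p
  · rw [hT, hT2, hTQ]
  have hmem : 𝔮 ∈ heightOneNeT p := ⟨h𝔮, hT⟩
  -- reduce the finsums to a common finite set
  have hS2 := finite_heightOneNeT_inter_support H2 hH2
  have hSQ := finite_heightOneNeT_inter_support Q hHZ
  set S : Finset (PrimeSpectrum (IwasawaAlgebra p)) := (hS2.union hSQ).toFinset with hS
  have hsub2 : heightOneNeT p ∩ Function.support (fun 𝔮 ↦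
      (Module.lengthAt (IwasawaAlgebra p) H2 𝔮).toNat * constVal p 𝔮) ⊆ S := by
    intro x hx; rw [hS, Set.Finite.coe_toFinset]; exact Or.inl hx
  have hsubQ : heightOneNeT p ∩ Function.support (fun 𝔮 ↦
      (Module.lengthAt (IwasawaAlgebra p) Q 𝔮).toNat * constVal p 𝔮) ⊆ S := by
    intro x hx; rw [hS, Set.Finite.coe_toFinset]; exact Or.inr hx
  have hSsub : (S : Set (PrimeSpectrum (IwasawaAlgebra p))) ⊆ heightOneNeT p := by
    intro x hx
    rw [hS, Set.Finite.coe_toFinset] at hx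
    rcases hx with hx | hx <;> exact hx.1
  have e2 : eulerExp p H2 = ∑ 𝔮 ∈ S, (Module.lengthAt (IwasawaAlgebra p) H2 𝔮).toNat * constVal p 𝔮 :=
    finsum_mem_eq_sum_of_subset _ hsub2 hSsub
  have eQ : eulerExp p Q = ∑ 𝔮 ∈ S, (Module.lengthAt (IwasawaAlgebra p) Q 𝔮).toNat * constVal p 𝔮 :=
    finsum_mem_eq_sum_of_subset _ hsubQ hSsub
  have hle : ∀ i ∈ S, (Module.lengthAt (IwasawaAlgebra p) H2 i).toNat * constVal p i ≤
      (Module.lengthAt (IwasawaAlgebra p) Q i).toNat * constVal p i := by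
    intro i hi
    have hi' := hSsub (Finset.mem_coe.mpr hi)
    exact Nat.mul_le_mul_right _ (ENat.toNat_le_toNat (hdiv i hi'.1)
      (IwasawaAlgebra.lengthAt_ne_top_of_isTorsion Q hHZ i (le_of_eq hi'.1)))
  have hsum : ∑ i ∈ S, (Module.lengthAt (IwasawaAlgebra p) H2 i).toNat * constVal p i =
      ∑ i ∈ S, (Module.lengthAt (IwasawaAlgebra p) Q i).toNat * constVal p i := by
    rw [← e2, ← eQ, hE]
  have hterm := (Finset.sum_eq_sum_iff_of_le hle).mp hsum
  -- is `𝔮 ∈ S`? if not, both lengths vanish there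
  by_cases h𝔮S : 𝔮 ∈ S
  · have h := hterm 𝔮 h𝔮S
    have hc : 0 < constVal p 𝔮 := one_le_constVal hmem
    have h' := Nat.eq_of_mul_eq_mul_right hc h
    have hfin2 := IwasawaAlgebra.lengthAt_ne_top_of_isTorsion H2 hH2 𝔮 (le_of_eq h𝔮)
    have hfinQ' := IwasawaAlgebra.lengthAt_ne_top_of_isTorsion Q hHZ 𝔮 (le_of_eq h𝔮)
    rw [← ENat.coe_toNat hfin2, ← ENat.coe_toNat hfinQ', h']
  · -- outside `S` both summands vanish, and `constVal ≥ 1`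
    have hc : 0 < constVal p 𝔮 := one_le_constVal hmem
    have h2z : (Module.lengthAt (IwasawaAlgebra p) H2 𝔮).toNat = 0 := by
      by_contra hne'
      exact h𝔮S (hsub2 ⟨hmem, Function.mem_support.mpr (Nat.mul_ne_zero hne' hc.ne')⟩)
    have hQz : (Module.lengthAt (IwasawaAlgebra p) Q 𝔮).toNat = 0 := by
      by_contra hne'
      exact h𝔮S (hsubQ ⟨hmem, Function.mem_support.mpr (Nat.mul_ne_zero hne' hc.ne')⟩)
    have hfin2 := IwasawaAlgebra.lengthAt_ne_top_of_isTorsion H2 hH2 𝔮 (le_of_eq h𝔮)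
    have hfinQ' := IwasawaAlgebra.lengthAt_ne_top_of_isTorsion Q hHZ 𝔮 (le_of_eq h𝔮)
    rw [← ENat.coe_toNat hfin2, ← ENat.coe_toNat hfinQ', h2z, hQz]

end Converse


end Literature.NumberTheory.EllipticCurves.Kato2004

end
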